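/- Copyright: the b2b-balaban cell (near-miss cell 7), T⁴-continuum fan-out, NE7b swarm leaf 04 (gen 5; road W-RP-VAR,
unbooked supplier «W3ᴮ»: the RP-extension step in the tree's bounded-RP currency).  Released under the licence of the
surrounding project. -/
import Mathlib.MeasureTheory.Function.FactorsThrough
import Literature.MathematicalPhysics.QuantumFieldTheory.LatticeRPSignRule
import Summits.QuantumFields.BalabanUV.T4Continuum.Support.HistoryRPTensor

/-!
# History chessboard road: reflection positivity SURVIVES the extension by block-bond kernels (RP-ext, iterable form)

Summits-side support leaf of the T⁴-continuum cell (rung (B)+1 on a FINITE torus only; NOT infinite volume, NOT the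
mass gap, NOT the Clay statement; NOT a proof of the spine estimate NE7b).  Road W-RP-VAR of the swarm claim table
`t4/b2b-balaban-t4-ne7b-p1/LEAVES-NE7b.md` (owner ruling R-OWNER-23-2; memo `t4/b2b-balaban-t4-ne7-p2/g27/IDEAS-NE7-g27.md`
§1 (RP-ext)(i)–(iii), step S4), an UNBOOKED supplier (journal INTENT of leaf-04 g5; nobody is obliged to consume it):
the junction between row W3 (`HistoryRPTensor`: the RP-tensor ∕ marginalisation lemma, per observable, complex
currency) and rows W5∕W4b (`HistoryChessboardRP.chessboardFields_of_isReflectionPositiveBdd`,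
`HistoryChessboardEvents.EventReading.rp`), which consume ∕ display reflection positivity in the TREE'S bounded form
`LatticeRP.IsReflectionPositiveBdd μ mP θ` (file `LatticeRPSignRule`).  [folklore] abstract measure theory
(Fröhlich–Israel–Lieb–Simon 1978 §2 ∕ Osterwalder–Seiler 1978 §2 style: «RP is stable under tensoring with a
reflection-symmetric pair of half-space integrations; normalised crossing integrations are invisible»); Mathlib + the
definition file + W3 (consumed BY NAME for the marginalisation identity) only; no `def`, no `structure`, no `[cite:]`
tag, nothing printed asserted, no Bałaban object instantiated.

CURRENCY.  Call **RP-package** of `(μ, mP, θ)` on a measurable space `(Ω, m)` the five sentences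
`mP ≤ m`, `Measurable θ`, `MeasurePreserving θ μ μ`, `θ ∘ θ = id`, `IsReflectionPositiveBdd μ mP θ` — exactly the
fields `mP_le`, `θ_meas`, `θ_pres`, `θ_invol`, `rp` that row W4b's `EventReading` DISPLAYS for the extended state
`μ K` at one block hyperplane `(i, k)`, and exactly what W5's `chessboardFields_of_isReflectionPositiveBdd` consumes.

WHAT.
* §0 two tools: Doob–Dynkin WITH A BOUND (`exists_eq_comp_of_measurable_comap`: a bounded real function measurable
  for the pull-back σ-algebra along `π` is a BOUNDED measurable function of `π`), and measurability of a kernel average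
  (`measurable_integral_kernel`).
* §1 (T2, the CROSSING block bonds) extension of `μ` by ANY Markov kernel `η : Kernel Ω Z`, reflection extended by a
  measurable `τ : Z → Z`, positive σ-algebra `mP.comap Prod.fst` (observables BLIND to the new coordinate):
  `isReflectionPositiveBdd_compProd_fst` (RP survives — the new coordinate integrates out, W3's
  `integral_fst_compProd_markov` BY NAME), `measurePreserving_compProd_covariant` (the extended reflection preserves
  `μ ⊗ₘ η` as soon as `η (θ ω) = (η ω).map τ` — COVARIANCE of the kernel), `crossExt_comp_self`, `comap_fst_le`;
  packaged as **`rpPackage_crossExt`** (RP-package in ⇒ RP-package out).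
* §2 (T1, W3's REFLECTED PAIR) extension of `μ` by `κ ×ₖ κ.comap θ` for a Markov kernel `κ : Kernel Ω Y` that READS
  POSITIVE-HALF DATA (`Measurable[mP] ⇑κ`): positive-half coordinate `y₊ ∼ κ ω`, negative-half coordinate
  `y₋ ∼ κ (θ ω)`, reflection `(ω, y₊, y₋) ↦ (θ ω, y₋, y₊)`, positive σ-algebra = `mP ⊗ m_Y` pulled back along
  `(ω, y₊, y₋) ↦ (ω, y₊)`: **`isReflectionPositiveBdd_pairExt`** (W3's `rp_compProd_prod_comap` with its per-observable
  hypothesis `hRP` DISCHARGED from the tree predicate: factorise the observable through `(ω, y₊)`, Fubini for `⊗ₘ`,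
  the product kernel splits the inner integral into `F̄ ω · F̄ (θ ω)` with `F̄` the κ-average — `mP`-measurable
  because `κ` is, bounded because `κ` is Markov — and `IsReflectionPositiveBdd μ mP θ` applied to `F̄`),
  `pairKernel_covariant` + `measurePreserving_pairExt` (§1 with `τ := Prod.swap`), `pairExt_comp_self`,
  `comap_pair_le`; packaged as **`rpPackage_pairExt`**.
* §3 **`rpPackage_level`**: ONE LEVEL = §2 then §1 (the level's own-half block-bond kernels as a reflected pair, then
  its crossing bonds), stated once so that `K` levels iterate BY NAME.
* §4 sanity: the hypotheses are inhabited (Dirac kernels over a one-point fibre; decided arithmetic control).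

WHAT IT BUYS (honest).  Iterating §3 from the base fine-link measure, W4b's displayed RP-package of the EXTENDED state
per block hyperplane reduces BY NAME to (a) the RP-package of the BASE measure (for Wilson's action this is in the tree
in this very form, see the header of `LatticeRPSignRule`) and (b) per level the STRUCTURAL sentences on the averaging
kernels relative to the hyperplane: (i) own-half kernels read own-half data (`Measurable[mP] ⇑κ`), (ii) the
negative-half kernel is the θ-transport of the positive-half one (the pair IS `κ ×ₖ κ.comap θ` — memo (RP-ext)(ii),
covariance of the prescription: TRUE for the CENTRED averaging prescription, FALSE for the printed corner prescription,
memo F1 ∕ `t4/T4-EST-NE7b-P1.md` (11c), unchanged by this file), (iii) crossing kernels are τ-covariant.  Whether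
Bałaban's level-`k` prescription, presented relative to a given hyperplane, HAS this product form is the instantiating
seat's (VAR)-shaped sentence; this file instantiates nothing and mints no `Prop` fact (trigger c1), touches no constant
(c2∕c6) and no exit ∕ socket ∕ `HistoryConstants` file (c3).  NE7b NOT proved; spine 0∕9.  HONEST DEPENDENCY (cell):
continuum YM on T⁴ ⇐ BetaPertH ∧ nine spine estimates (0/9 proved); BetaPertH ⇐ (D1) ∧ (D4) ∧ CAP+tail; G-an2-4 gates
asym, D1 and NE2/3/4.  This file changes none of it. -/

open MeasureTheory ProbabilityTheory
open Literature.MathematicalPhysics.QuantumFieldTheory.LatticeRP (IsReflectionPositiveBdd)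

namespace Summit.QuantumFields.BalabanUV.T4Continuum.HistoryRPExtension

noncomputable section

/-! ## §0 Two tools: Doob–Dynkin with a bound; measurability of a kernel average -/

/-- **Doob–Dynkin with a bound.**  A real function `g` on `X`, measurable for the pull-back σ-algebra `mB.comap π`
along `π : X → B` and bounded by `C`, is a BOUNDED `mB`-measurable function of `π`: `g = h ∘ π` with `|h| ≤ max C 0`
(Mathlib's `Measurable.exists_eq_measurable_comp`, then truncation at `± max C 0`, which does not change `h` on the
range of `π`). [folklore] -/
theorem exists_eq_comp_of_measurable_comap {X B : Type*} {mB : MeasurableSpace B} {π : X → B} {g : X → ℝ}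
    (hg : Measurable[mB.comap π] g) {C : ℝ} (hC : ∀ x, |g x| ≤ C) :
    ∃ h : B → ℝ, Measurable[mB] h ∧ (∀ b, |h b| ≤ max C 0) ∧ ∀ x, g x = h (π x) := by
  obtain ⟨h, hm, hgh⟩ := hg.exists_eq_measurable_comp
  refine ⟨fun b => max (-max C 0) (min (max C 0) (h b)), measurable_const.max (measurable_const.min hm),
    fun b => ?_, fun x => ?_⟩
  · exact abs_le.2 ⟨le_max_left _ _, max_le (neg_le_self (le_max_right C 0)) (min_le_left _ _)⟩
  · have h1 : g x = h (π x) := congrFun hgh x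
    have hx : |h (π x)| ≤ max C 0 := by rw [← h1]; exact (hC x).trans (le_max_left C 0)
    obtain ⟨hlo, hhi⟩ := abs_le.1 hx
    show g x = max (-max C 0) (min (max C 0) (h (π x)))
    rw [min_eq_right hhi, max_eq_right hlo, h1]

/-- **A kernel average of a measurable function is measurable** (in whatever σ-algebra the kernel is a kernel for):
`a ↦ ∫ h (a, b) κ(a, db)` is measurable for measurable real `h` and an s-finite kernel `κ`
(`StronglyMeasurable.integral_kernel_prod_right'`). [folklore] -/
theorem measurable_integral_kernel {α β : Type*} {mα : MeasurableSpace α} {mβ : MeasurableSpace β}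
    (κ : Kernel α β) [IsSFiniteKernel κ] {h : α × β → ℝ} (hh : Measurable h) :
    Measurable fun a => ∫ b, h (a, b) ∂κ a :=
  (hh.stronglyMeasurable.integral_kernel_prod_right' (κ := κ)).measurable

/-- A kernel average of a function bounded by `M` is bounded by `M` (Markov kernel). [folklore] -/
theorem abs_integral_kernel_le {α β : Type*} {mα : MeasurableSpace α} {mβ : MeasurableSpace β}
    (κ : Kernel α β) [IsMarkovKernel κ] {h : α × β → ℝ} {M : ℝ} (hb : ∀ p, |h p| ≤ M) (a : α) :
    |∫ b, h (a, b) ∂κ a| ≤ M := by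
  have := norm_integral_le_of_norm_le_const (μ := κ a) (f := fun b => h (a, b)) (C := M)
    (ae_of_all _ fun b => by rw [Real.norm_eq_abs]; exact hb (a, b))
  simpa [Real.norm_eq_abs, probReal_univ] using this

/-! ## §1 (T2) Extension by a covariant Markov kernel, observables blind to the new coordinate (crossing bonds) -/

section Crossing

variable {Ω Z : Type*} {mP : MeasurableSpace Ω} [m : MeasurableSpace Ω] [mZ : MeasurableSpace Z]

/-- The extended reflection `(ω, z) ↦ (θ ω, τ z)` is measurable. [folklore] -/
theorem measurable_crossExt {θ : Ω → Ω} (hθ : Measurable θ) {τ : Z → Z} (hτ : Measurable τ) :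
    Measurable fun q : Ω × Z => (θ q.1, τ q.2) :=
  (hθ.comp measurable_fst).prodMk (hτ.comp measurable_snd)

omit m mZ in
/-- The extended reflection is an involution when `θ` and `τ` are. [folklore] -/
theorem crossExt_comp_self {θ : Ω → Ω} (hθθ : θ ∘ θ = id) {τ : Z → Z} (hττ : τ ∘ τ = id) :
    ((fun q : Ω × Z => (θ q.1, τ q.2)) ∘ fun q : Ω × Z => (θ q.1, τ q.2)) = id := by
  funext q
  have h1 : θ (θ q.1) = q.1 := congrFun hθθ q.1
  have h2 : τ (τ q.2) = q.2 := congrFun hττ q.2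
  simp only [Function.comp_apply, h1, h2, id_eq, Prod.mk.eta]

/-- The positive σ-algebra of the extension (observables BLIND to the new coordinate: `mP` pulled back along
`Prod.fst`) is a sub-σ-algebra of the product σ-algebra. [folklore] -/
theorem comap_fst_le (hm : mP ≤ m) :
    mP.comap (Prod.fst : Ω × Z → Ω) ≤ m.prod mZ :=
  (MeasurableSpace.comap_mono hm).trans measurable_fst.comap_le

/-- **(T2) MEASURE PRESERVATION.**  If `θ` preserves `μ` and the Markov kernel `η` is COVARIANT —
`η (θ ω) = (η ω).map τ` (in the road: the crossing block-bond kernel at the reflected base point is the τ-image of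
the kernel at the base point, `τ` = the bond reflection on the crossing variables) — then the extended reflection
`(ω, z) ↦ (θ ω, τ z)` preserves `μ ⊗ₘ η`.  (No involution is needed here.) [folklore] -/
theorem measurePreserving_compProd_covariant {μ : Measure Ω} [SFinite μ] {θ : Ω → Ω}
    (hθ : MeasurePreserving θ μ μ) (η : Kernel Ω Z) [IsSFiniteKernel η] {τ : Z → Z} (hτ : Measurable τ)
    (hcov : ∀ ω, η (θ ω) = (η ω).map τ) :
    MeasurePreserving (fun q : Ω × Z => (θ q.1, τ q.2)) (μ ⊗ₘ η) (μ ⊗ₘ η) := by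
  have hT : Measurable fun q : Ω × Z => (θ q.1, τ q.2) := measurable_crossExt hθ.measurable hτ
  refine ⟨hT, ?_⟩
  ext s hs
  rw [Measure.map_apply hT hs, Measure.compProd_apply (hT hs), Measure.compProd_apply hs]
  have hF : Measurable fun a : Ω => η a (Prod.mk a ⁻¹' s) := Kernel.measurable_kernel_prodMk_left hs
  calc ∫⁻ ω, η ω (Prod.mk ω ⁻¹' ((fun q : Ω × Z => (θ q.1, τ q.2)) ⁻¹' s)) ∂μ
      = ∫⁻ ω, η (θ ω) (Prod.mk (θ ω) ⁻¹' s) ∂μ := by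
        refine lintegral_congr fun ω => ?_
        have hsec : Prod.mk ω ⁻¹' ((fun q : Ω × Z => (θ q.1, τ q.2)) ⁻¹' s) = τ ⁻¹' (Prod.mk (θ ω) ⁻¹' s) :=
          rfl
        rw [hsec, hcov ω, Measure.map_apply hτ (measurable_prodMk_left hs)]
    _ = ∫⁻ a, η a (Prod.mk a ⁻¹' s) ∂μ := hθ.lintegral_comp hF

/-- **(T2) REFLECTION POSITIVITY SURVIVES A MARKOV EXTENSION, for observables blind to the new coordinate.**  For ANY
Markov kernel `η : Kernel Ω Z` and ANY `τ : Z → Z`: an observable measurable for `mP.comap Prod.fst` is a function of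
the base point alone (Doob–Dynkin), the new coordinate integrates out (W3's `integral_fst_compProd_markov`), and
`IsReflectionPositiveBdd μ mP θ` applies.  (In the road: the crossing block bonds are invisible to observables of the
open positive half.) [folklore] -/
theorem isReflectionPositiveBdd_compProd_fst (hm : mP ≤ m) {μ : Measure Ω}
    [SFinite μ] {θ : Ω → Ω} (hθ : Measurable θ) (η : Kernel Ω Z) [IsMarkovKernel η] (τ : Z → Z)
    (hRP : IsReflectionPositiveBdd μ mP θ) :
    IsReflectionPositiveBdd (μ ⊗ₘ η) (mP.comap (Prod.fst : Ω × Z → Ω)) (fun q : Ω × Z => (θ q.1, τ q.2)) := by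
  intro g hg hgb
  show 0 ≤ ∫ q, g (θ q.1, τ q.2) * g q ∂(μ ⊗ₘ η)
  obtain ⟨C, hC⟩ := hgb
  obtain ⟨h, hmeas, hbdd, hgh⟩ := exists_eq_comp_of_measurable_comap hg hC
  have hmeas' : Measurable h := hmeas.mono hm le_rfl
  have hG : (fun q : Ω × Z => g (θ q.1, τ q.2) * g q) = fun q => h (θ q.1) * h q.1 := by
    funext q; rw [hgh, hgh]
  have hprod : AEStronglyMeasurable (fun ω => h (θ ω) * h ω) μ :=
    ((hmeas'.comp hθ).mul hmeas').aestronglyMeasurable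
  rw [hG, HistoryRPTensor.integral_fst_compProd_markov μ η (g := fun ω => h (θ ω) * h ω) hprod]
  exact hRP h hmeas ⟨_, hbdd⟩

/-- **(T2) PACKAGED: RP-package in ⇒ RP-package out** for the extension by a covariant Markov kernel with
observables blind to the new coordinate (`τ` a measurable involution): the five sentences `mP ≤ m`, `Measurable θ`,
`MeasurePreserving θ μ μ`, `θ ∘ θ = id`, `IsReflectionPositiveBdd μ mP θ` transport to
`(μ ⊗ₘ η, mP.comap Prod.fst, (ω, z) ↦ (θ ω, τ z))`. [folklore] -/
theorem rpPackage_crossExt (hm : mP ≤ m) {μ : Measure Ω} [SFinite μ]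
    {θ : Ω → Ω} (hθm : Measurable θ) (hθ : MeasurePreserving θ μ μ) (hθθ : θ ∘ θ = id)
    (hRP : IsReflectionPositiveBdd μ mP θ) (η : Kernel Ω Z) [IsMarkovKernel η] {τ : Z → Z}
    (hτ : Measurable τ) (hττ : τ ∘ τ = id) (hcov : ∀ ω, η (θ ω) = (η ω).map τ) :
    mP.comap (Prod.fst : Ω × Z → Ω) ≤ m.prod mZ ∧
      Measurable (fun q : Ω × Z => (θ q.1, τ q.2)) ∧
      MeasurePreserving (fun q : Ω × Z => (θ q.1, τ q.2)) (μ ⊗ₘ η) (μ ⊗ₘ η) ∧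
      ((fun q : Ω × Z => (θ q.1, τ q.2)) ∘ fun q : Ω × Z => (θ q.1, τ q.2)) = id ∧
      IsReflectionPositiveBdd (μ ⊗ₘ η) (mP.comap (Prod.fst : Ω × Z → Ω)) (fun q : Ω × Z => (θ q.1, τ q.2)) :=
  ⟨comap_fst_le hm, measurable_crossExt hθm hτ, measurePreserving_compProd_covariant hθ η hτ hcov,
    crossExt_comp_self hθθ hττ, isReflectionPositiveBdd_compProd_fst hm hθm η τ hRP⟩

end Crossing

/-! ## §2 (T1) Extension by the REFLECTED PAIR of a positive-half Markov kernel (W3's object, bounded-RP currency) -/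

section Pair

variable {Ω Y : Type*} {mP : MeasurableSpace Ω} [m : MeasurableSpace Ω] [mY : MeasurableSpace Y]

/-- The extended reflection `(ω, y₊, y₋) ↦ (θ ω, y₋, y₊)` is measurable. [folklore] -/
theorem measurable_pairExt {θ : Ω → Ω} (hθ : Measurable θ) :
    Measurable fun p : Ω × (Y × Y) => (θ p.1, p.2.swap) :=
  (hθ.comp measurable_fst).prodMk (measurable_swap.comp measurable_snd)

omit m mY in
/-- The extended reflection is an involution when `θ` is. [folklore] -/
theorem pairExt_comp_self {θ : Ω → Ω} (hθθ : θ ∘ θ = id) :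
    ((fun p : Ω × (Y × Y) => (θ p.1, p.2.swap)) ∘ fun p : Ω × (Y × Y) => (θ p.1, p.2.swap)) = id :=
  crossExt_comp_self hθθ (funext Prod.swap_swap)

/-- The product σ-algebra is monotone in the first factor. [folklore] -/
theorem prod_mono_left (hm : mP ≤ m) : mP.prod mY ≤ m.prod mY := by
  simp only [MeasurableSpace.prod]
  exact sup_le_sup_right (MeasurableSpace.comap_mono hm) _

/-- The positive σ-algebra of the pair extension — `mP ⊗ m_Y` pulled back along `(ω, y₊, y₋) ↦ (ω, y₊)`:
observables of the positive-half base data and of the NEW POSITIVE-HALF coordinate — is a sub-σ-algebra of the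
product σ-algebra. [folklore] -/
theorem comap_pair_le (hm : mP ≤ m) :
    (mP.prod mY).comap (fun p : Ω × (Y × Y) => (p.1, p.2.1)) ≤ m.prod (mY.prod mY) :=
  (MeasurableSpace.comap_mono (prod_mono_left hm)).trans
    (measurable_fst.prodMk (measurable_fst.comp measurable_snd)).comap_le

/-- **COVARIANCE OF THE REFLECTED PAIR.**  For an involution `θ`, the pair kernel `κ ×ₖ κ.comap θ` at the reflected
base point is the SWAP-image of the pair kernel at the base point:
`(κ ×ₖ κ.comap θ) (θ ω) = κ (θ ω) ⊗ κ ω = ((κ ω) ⊗ κ (θ ω)).map Prod.swap`. [folklore] -/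
theorem pairKernel_covariant {θ : Ω → Ω} (hθ : Measurable θ) (hθθ : θ ∘ θ = id) (κ : Kernel Ω Y)
    [IsMarkovKernel κ] (ω : Ω) :
    (κ ×ₖ κ.comap θ hθ) (θ ω) = ((κ ×ₖ κ.comap θ hθ) ω).map Prod.swap := by
  have h1 : θ (θ ω) = ω := congrFun hθθ ω
  rw [Kernel.prod_apply, Kernel.prod_apply, Kernel.comap_apply, Kernel.comap_apply, h1, Measure.prod_swap]

/-- **(T1) MEASURE PRESERVATION.**  If `θ` is a `μ`-preserving involution then the extended reflection
`(ω, y₊, y₋) ↦ (θ ω, y₋, y₊)` preserves the pair-extended measure `μ ⊗ₘ (κ ×ₖ κ.comap θ)` (§1 with `τ := Prod.swap`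
and `pairKernel_covariant`). [folklore] -/
theorem measurePreserving_pairExt {μ : Measure Ω} [SFinite μ] {θ : Ω → Ω} (hθm : Measurable θ)
    (hθ : MeasurePreserving θ μ μ) (hθθ : θ ∘ θ = id) (κ : Kernel Ω Y) [IsMarkovKernel κ] :
    MeasurePreserving (fun p : Ω × (Y × Y) => (θ p.1, p.2.swap))
      (μ ⊗ₘ (κ ×ₖ κ.comap θ hθm)) (μ ⊗ₘ (κ ×ₖ κ.comap θ hθm)) :=
  measurePreserving_compProd_covariant hθ _ measurable_swap (pairKernel_covariant hθm hθθ κ)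

/-- **(T1) REFLECTION POSITIVITY SURVIVES THE EXTENSION BY A REFLECTED PAIR OF POSITIVE-HALF MARKOV KERNELS**
(bounded-RP currency; W3's `HistoryRPTensor.rp_compProd_prod_comap` with its per-observable hypothesis discharged
from the tree predicate).  Let `mP ≤ m`, `θ` measurable, `μ` finite with `IsReflectionPositiveBdd μ mP θ`, and let the
Markov kernel `κ : Kernel Ω Y` READ POSITIVE-HALF DATA: `Measurable[mP] ⇑κ`.  Then the measure
`μ ⊗ₘ (κ ×ₖ κ.comap θ)` (positive-half coordinate `y₊ ∼ κ ω`, negative-half coordinate `y₋ ∼ κ (θ ω)`) is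
reflection positive in the bounded form for the reflection `(ω, y₊, y₋) ↦ (θ ω, y₋, y₊)` and the positive
σ-algebra `(mP ⊗ m_Y).comap ((ω, y₊, y₋) ↦ (ω, y₊))`.  Proof: a bounded observable of that σ-algebra is `h (ω, y₊)`
with `h` bounded and `mP ⊗ m_Y`-measurable (§0); by Fubini for `⊗ₘ` and the product structure of the pair kernel,
`∫ h(θω, y₋) h(ω, y₊) = ∫ F̄ (θ ω) F̄ ω dμ` with the κ-average `F̄ ω = ∫ h (ω, y) κ(ω, dy)`, which is bounded
(`κ` Markov) and `mP`-measurable (`κ` is an `mP`-kernel); conclude by `IsReflectionPositiveBdd μ mP θ`. [folklore] -/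
theorem isReflectionPositiveBdd_pairExt (hm : mP ≤ m) {μ : Measure Ω}
    [IsFiniteMeasure μ] {θ : Ω → Ω} (hθ : Measurable θ) (κ : Kernel Ω Y) [IsMarkovKernel κ]
    (hκ : Measurable[mP] (κ : Ω → Measure Y)) (hRP : IsReflectionPositiveBdd μ mP θ) :
    IsReflectionPositiveBdd (μ ⊗ₘ (κ ×ₖ κ.comap θ hθ))
      ((mP.prod mY).comap (fun p : Ω × (Y × Y) => (p.1, p.2.1)))
      (fun p : Ω × (Y × Y) => (θ p.1, p.2.swap)) := by
  intro g hg hgb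
  show 0 ≤ ∫ p, g (θ p.1, p.2.swap) * g p ∂(μ ⊗ₘ (κ ×ₖ κ.comap θ hθ))
  obtain ⟨C, hC⟩ := hgb
  obtain ⟨h, hmeas, hbdd, hgh⟩ := exists_eq_comp_of_measurable_comap hg hC
  -- `h : Ω × Y → ℝ`, `Measurable[mP.prod mY] h`, `|h| ≤ M`, `g p = h (p.1, p.2.1)`
  set M : ℝ := max C 0
  have hmeas' : Measurable h := hmeas.mono (prod_mono_left hm) le_rfl
  -- the κ-average of `h`
  set F : Ω → ℝ := fun ω => ∫ y, h (ω, y) ∂κ ω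
  have hFm : Measurable[mP] F := by
    let κP : @Kernel Ω Y mP mY := @Kernel.mk Ω Y mP mY (κ : Ω → Measure Y) hκ
    haveI : @IsMarkovKernel Ω Y mP mY κP := ⟨fun a => (inferInstance : IsProbabilityMeasure (κ a))⟩
    exact measurable_integral_kernel (mα := mP) κP hmeas
  have hFb : ∀ ω, |F ω| ≤ M := fun ω => abs_integral_kernel_le κ hbdd ω
  -- the reflected product observable, as a function of `h`
  have hG : (fun p : Ω × (Y × Y) => g (θ p.1, p.2.swap) * g p) =
      fun p => h (θ p.1, p.2.2) * h (p.1, p.2.1) := by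
    funext p; rw [hgh, hgh]; rfl
  have hGm : Measurable fun p : Ω × (Y × Y) => h (θ p.1, p.2.2) * h (p.1, p.2.1) :=
    (hmeas'.comp ((hθ.comp measurable_fst).prodMk (measurable_snd.comp measurable_snd))).mul
      (hmeas'.comp (measurable_fst.prodMk (measurable_fst.comp measurable_snd)))
  have hGi : Integrable (fun p : Ω × (Y × Y) => h (θ p.1, p.2.2) * h (p.1, p.2.1))
      (μ ⊗ₘ (κ ×ₖ κ.comap θ hθ)) :=
    Integrable.of_bound hGm.aestronglyMeasurable (M * M) (ae_of_all _ fun p => by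
      rw [Real.norm_eq_abs, abs_mul]
      exact mul_le_mul (hbdd _) (hbdd _) (abs_nonneg _) ((abs_nonneg _).trans (hbdd (p.1, p.2.1))))
  rw [hG, Measure.integral_compProd hGi]
  -- the inner integral over the pair kernel splits into `F̄ ω · F̄ (θ ω)`
  have inner : ∀ ω, ∫ q, h (θ (ω, q).1, (ω, q).2.2) * h ((ω, q).1, (ω, q).2.1)
      ∂((κ ×ₖ κ.comap θ hθ) ω) = F (θ ω) * F ω := by
    intro ω
    show ∫ q, h (θ ω, q.2) * h (ω, q.1) ∂((κ ×ₖ κ.comap θ hθ) ω) = F (θ ω) * F ω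
    have hswap : (fun q : Y × Y => h (θ ω, q.2) * h (ω, q.1)) = fun q => h (ω, q.1) * h (θ ω, q.2) :=
      funext fun q => mul_comm _ _
    rw [Kernel.prod_apply, Kernel.comap_apply, hswap,
      integral_prod_mul (μ := κ ω) (ν := κ (θ ω)) (fun y => h (ω, y)) (fun y => h (θ ω, y)), mul_comm]
  simp_rw [inner]
  exact hRP F hFm ⟨M, hFb⟩

/-- **(T1) PACKAGED: RP-package in ⇒ RP-package out** for the extension by the reflected pair of a positive-half
Markov kernel: the five sentences transport from `(μ, mP, θ)` to
`(μ ⊗ₘ (κ ×ₖ κ.comap θ), (mP ⊗ m_Y).comap ((ω,y₊,y₋) ↦ (ω,y₊)), (ω,y₊,y₋) ↦ (θ ω, y₋, y₊))`. [folklore] -/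
theorem rpPackage_pairExt (hm : mP ≤ m) {μ : Measure Ω} [IsFiniteMeasure μ]
    {θ : Ω → Ω} (hθm : Measurable θ) (hθ : MeasurePreserving θ μ μ) (hθθ : θ ∘ θ = id)
    (hRP : IsReflectionPositiveBdd μ mP θ) (κ : Kernel Ω Y) [IsMarkovKernel κ]
    (hκ : Measurable[mP] (κ : Ω → Measure Y)) :
    (mP.prod mY).comap (fun p : Ω × (Y × Y) => (p.1, p.2.1)) ≤ m.prod (mY.prod mY) ∧
      Measurable (fun p : Ω × (Y × Y) => (θ p.1, p.2.swap)) ∧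
      MeasurePreserving (fun p : Ω × (Y × Y) => (θ p.1, p.2.swap))
        (μ ⊗ₘ (κ ×ₖ κ.comap θ hθm)) (μ ⊗ₘ (κ ×ₖ κ.comap θ hθm)) ∧
      ((fun p : Ω × (Y × Y) => (θ p.1, p.2.swap)) ∘ fun p : Ω × (Y × Y) => (θ p.1, p.2.swap)) = id ∧
      IsReflectionPositiveBdd (μ ⊗ₘ (κ ×ₖ κ.comap θ hθm))
        ((mP.prod mY).comap (fun p : Ω × (Y × Y) => (p.1, p.2.1)))
        (fun p : Ω × (Y × Y) => (θ p.1, p.2.swap)) :=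
  ⟨comap_pair_le hm, measurable_pairExt hθm, measurePreserving_pairExt hθm hθ hθθ κ, pairExt_comp_self hθθ,
    isReflectionPositiveBdd_pairExt hm hθm κ hκ hRP⟩

end Pair

/-! ## §3 ONE LEVEL: the own-half block bonds as a reflected pair, then the crossing bonds -/

section Level

variable {Ω Y Z : Type*} {mP : MeasurableSpace Ω} [m : MeasurableSpace Ω] [mY : MeasurableSpace Y]
  [mZ : MeasurableSpace Z]

/-- **ONE LEVEL OF THE EXTENDED MEASURE, relative to one block hyperplane** (RP-package in ⇒ RP-package out; iterate
`K` times BY NAME).  Data of the level: the positive-half block-bond kernel `κ : Kernel Ω Y` (Markov, READING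
POSITIVE-HALF DATA `Measurable[mP] ⇑κ`; the negative-half bonds are drawn from `κ (θ ω)` — memo (RP-ext)(ii), the
centred prescription's covariance), then the crossing-bond kernel `η` on the pair-extended space (Markov, covariant
under the pair-extended reflection for a measurable involution `τ` of the crossing variables — memo (RP-ext)(i)(iii)).
Output: the five sentences for the level's full extension
`((μ ⊗ₘ (κ ×ₖ κ.comap θ)) ⊗ₘ η, positive σ-algebra of (ω, y₊) pulled back, ((ω,y₊,y₋),z) ↦ ((θω,y₋,y₊), τ z))`
— the shape W4b's `EventReading` displays at one `(K, i, k)` and W5 consumes. [folklore] -/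
theorem rpPackage_level (hm : mP ≤ m) {μ : Measure Ω} [IsFiniteMeasure μ]
    {θ : Ω → Ω} (hθm : Measurable θ) (hθ : MeasurePreserving θ μ μ) (hθθ : θ ∘ θ = id)
    (hRP : IsReflectionPositiveBdd μ mP θ) (κ : Kernel Ω Y) [IsMarkovKernel κ]
    (hκ : Measurable[mP] (κ : Ω → Measure Y))
    (η : Kernel (Ω × (Y × Y)) Z) [IsMarkovKernel η] {τ : Z → Z} (hτ : Measurable τ) (hττ : τ ∘ τ = id)
    (hcov : ∀ p : Ω × (Y × Y), η (θ p.1, p.2.swap) = (η p).map τ) :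
    ((mP.prod mY).comap (fun p : Ω × (Y × Y) => (p.1, p.2.1))).comap
          (Prod.fst : (Ω × (Y × Y)) × Z → Ω × (Y × Y)) ≤ (m.prod (mY.prod mY)).prod mZ ∧
      Measurable (fun q : (Ω × (Y × Y)) × Z => ((θ q.1.1, q.1.2.swap), τ q.2)) ∧
      MeasurePreserving (fun q : (Ω × (Y × Y)) × Z => ((θ q.1.1, q.1.2.swap), τ q.2))
        ((μ ⊗ₘ (κ ×ₖ κ.comap θ hθm)) ⊗ₘ η) ((μ ⊗ₘ (κ ×ₖ κ.comap θ hθm)) ⊗ₘ η) ∧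
      ((fun q : (Ω × (Y × Y)) × Z => ((θ q.1.1, q.1.2.swap), τ q.2)) ∘
          fun q : (Ω × (Y × Y)) × Z => ((θ q.1.1, q.1.2.swap), τ q.2)) = id ∧
      IsReflectionPositiveBdd ((μ ⊗ₘ (κ ×ₖ κ.comap θ hθm)) ⊗ₘ η)
        (((mP.prod mY).comap (fun p : Ω × (Y × Y) => (p.1, p.2.1))).comap
          (Prod.fst : (Ω × (Y × Y)) × Z → Ω × (Y × Y)))
        (fun q : (Ω × (Y × Y)) × Z => ((θ q.1.1, q.1.2.swap), τ q.2)) := by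
  obtain ⟨h1, h2, h3, h4, h5⟩ := rpPackage_pairExt hm hθm hθ hθθ hRP κ hκ
  exact rpPackage_crossExt h1 h2 h3 h4 h5 η hτ hττ hcov

end Level

/-! ## §4 Sanity: the hypotheses are inhabited; a decided control -/

section Sanity

/-- The reflected-pair hypotheses are INHABITED: over any base `(μ, mP, θ)` carrying an RP-package, the constant
(deterministic) kernel into a one-point fibre reads positive-half data, so §2 applies — e.g. to the one-point base
with the Dirac state and the identity reflection, which is trivially reflection positive. [folklore] -/
example : IsReflectionPositiveBdd
    ((Measure.dirac () : Measure Unit) ⊗ₘ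
      ((Kernel.const Unit (Measure.dirac ())) ×ₖ (Kernel.const Unit (Measure.dirac ())).comap id measurable_id))
    ((PUnit.instMeasurableSpace.prod PUnit.instMeasurableSpace).comap
      (fun p : Unit × (Unit × Unit) => (p.1, p.2.1)))
    (fun p : Unit × (Unit × Unit) => (id p.1, p.2.swap)) := by
  refine isReflectionPositiveBdd_pairExt (mP := PUnit.instMeasurableSpace) le_rfl measurable_id _
    (Kernel.const Unit (Measure.dirac ())).measurable ?_
  intro g _ _
  show 0 ≤ ∫ ω, g (id ω) * g ω ∂(Measure.dirac ())
  rw [integral_dirac]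
  exact mul_self_nonneg _

/-- Decided control of the truncation used in §0: truncating at `± max C 0` fixes every value of modulus `≤ C`. -/
example (C v : ℝ) (hv : |v| ≤ C) : max (-max C 0) (min (max C 0) v) = v := by
  obtain ⟨hlo, hhi⟩ := abs_le.1 (hv.trans (le_max_left C 0))
  rw [min_eq_right hhi, max_eq_right hlo]

end Sanity

end

end Summit.QuantumFields.BalabanUV.T4Continuum.HistoryRPExtension
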